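import Summits.QuantumFields.BalabanUV.Beta.FP.TorusCompositeRowsSymSandwich
import Summits.QuantumFields.BalabanUV.Beta.FP.TorusCompanionSumPeriodic
import Summits.QuantumFields.BalabanUV.Beta.FP.TorusCompanionCorePeriodic
import Summits.QuantumFields.BalabanUV.Beta.FP.TorusTwoScaleSandwichLetters
import Literature.MathematicalPhysics.QuantumFieldTheory.Balaban1983to89.Beta.InterLevelTransport

/-!
# `BalabanUV.Beta.FP.TorusCompanionLamPacked` — road «FP» for binder row D1, ROUTE T (β1), J-RISK-3′ «THE PACKING AT THE PASS», SPEC-48 (B2′) — THE ASSEMBLY: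
# **THE END WRAPPER's Λ-COMPANION TERM `compSumSym Lc (onTowerFamily Lc M (k ↦ w k • Σ_ā hb k ā • (perF T_k (dper T_k (SLam N (cf k) 𝒽 ā)))|ff)) M lev rs n` IS ONE
# PERIODISED LATTICE KERNEL `perF T (dper T (Σ_{j<n} 𝒦_j))` ON THE FINEST TORUS — storey kernel `𝒦_j` = the sandwich of the storey's Λ-core by an2's composite linear
# legs at the sym bricks; the only letter: every Λ-brick `SLam N (cf j) 𝒽 κ u` bi-localised at its bond (an2's `LocStencil` currency)**

WHY.  The END wrapper `StepRecursionFeedNestedNamedB.d1Tel_JcComp_ctr_named` (p405971 ✓) pins the first-order H-side jet `H₁f v` as `(−2c)•Σ hb W|ff + w•Σ hb Λ|ff +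
compSumSym Lc (onTowerFamily Lc M′ F_v) M′ lev rs (n+1)` (`hH₁f`), while the N-binding `hHN₁` reads it as ONE periodised lattice kernel.  The g36 chain typed the road's
half of R-FP-75 generically: the engine (`TorusTwoScaleSandwichPeriodic` p408072 ✓), the rows as a periodised two-scale leg (`TorusCompositeRowsSymKernel` p408305 ✓), one
storey at the named rows (`TorusCompositeRowsSymSandwich` p408501 ✓), the storey sum (`TorusCompanionSumPeriodic` p408619 ✓), the storey core (`TorusCompanionCorePeriodic`)
and the sandwich's letters (`TorusTwoScaleSandwichLetters`).  THIS FILE assembles them AT THE WRAPPER's SPELLING of the companion family: for storey prescriptions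
`F k := w k • Σ_{ā ∈ T_k-bonds} hb k ā • (perF T_k (dper T_k (SLam N (cf k) 𝒽 ā.2 ā.1)))|ff` (`T_k := towerTorus Lc M k`; in the wrapper `𝒽 μ y := symHessFFAt ρ_c Lc μ y`,
`hb k := hb n B k v`, `cf k := cf n B k`, `w := w n`, `lev i := n+1−i`), the whole companion sum is `perF T (dper T (Σ_{j<n} 𝒦_j))`, `T := towerTorus Lc M n`, with
`𝒦_j` DISPLAYED (window-free) as the sandwich of the core `w j · Σ_ā hb j ā · (SLam N (cf j) 𝒽 ā)^{ff}` by an2's `compLinKer ℓ Lc (n − j)` at ONE brick list `ℓ` for the whole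
tower (`ℓ i = stepScale d Lc (lev (n − i)) · Lc^{d+1} · symLinKerAt (ctr (d+1) Lc) Lc`, displayed below the depth).

WHAT ([folklore] composition BY NAME; no `def`, no `def … : Prop`, nothing cited, 0 sorry): **`compSumSym_lam_eq_perF_dper`** under `2 ≤ Lc`, `hℓ`, the bricks' bi-localisation
`hLS : ∀ j, LocStencil (SLam N (cf j) 𝒽) (Cs j) δ` (`0 ≤ Cs j`, `0 < δ`) and the display `h𝒦`.  Per storey `j + c = n`: `TorusCompanionCorePeriodic.perF_dper_core_of_biLoc`
(the prescription is the periodised core) + `TorusCompositeRowsSymSandwich.compRowsSym_transpose_mul_perF_dper_mul` (one storey packed; the core's letters by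
`summable_core_diag ∕ _right`, the bricks' by `summable_ff_diag ∕ _right_of_biLoc`); the storeys summed by `TorusCompanionSumPeriodic.compSumSym_onTowerFamily_eq_perF_dper_sum`
with the sandwich letters of `TorusTwoScaleSandwichLetters` (`_of_tsum` twins, windows from `exists_rowsLeg_window`, equivariance from `rowsLeg_translate`) moved to the
finest torus along `towerTorus_towerTorus` (§1: `towerTorus Lc (towerTorus Lc M j) c = towerTorus Lc M (j + c)`).
WHAT THIS IS NOT: not the identification of `Σ_j 𝒦_j` (+ the top Λ term + the W term) with the Λ-member of an2's `VN` ((B4), the row's: `compHessFF_unroll` ∕ `liftUp`ᵀ);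
not a discharge of `LocStencil (SLam N (cf j) 𝒽)` (an2's `InterLevelTransport.locStencil_SLam` from a decay letter on `cf j` and `VertexFamily 𝒽` — the wrapper displays
only the summability letter `hcf`); no row of the END wrapper discharged; no estimate; nothing of Bałaban's asserted, valued or discharged; 0∕4 row-D1 binders
(hW, hR, D1Tel, D1Rep); ROOT M‴ p325680 untouched; NOT (C1), NOT (L2′), NOT (T-ID), NOT SDF, NOT D1, NOT BetaPertH, NOT continuum, NOT Clay.

HONEST DEPENDENCY (page 1, mandatory): continuum YM on T⁴ ⇐ BetaPertH ∧ nine spine estimates (0/9 proved); BetaPertH ⇐ (D1) ∧ (D4) ∧ CAP+tail;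
G-an2-4 gates asym, D1 and NE2/3/4.  HONEST FRAMING (cell contract, verbatim): «discharging `BetaPertH` makes Bałaban's UV stability UNCONDITIONAL —
a real constructive-QFT result; it is NOT the continuum limit and NOT the Clay problem.»  ABSOLUTE RULE (cell charter, verbatim): «No internally-minted
statement may enter as a cited fact. Every hypothesis is either kernel-proved in this package or a verbatim quotation of a PUBLISHED theorem with page
reference. The manuscript(s) under audit are NOT citable for their own disputed steps — they are the thing under adjudication; programme-internal
(2001/route/tribunal) claims are never citable.»  Road «FP» OWNER, b2b-balaban-beta-d1-p3 gen 36, 2026-08-25.  No existing file touched.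
-/

noncomputable section

open scoped BigOperators

namespace Summit.QuantumFields.BalabanUV.Beta.FP.TorusCompanionLamPacked

open Finset Matrix
open Literature.MathematicalPhysics.QuantumFieldTheory.Balaban1983to89
open Literature.MathematicalPhysics.QuantumFieldTheory.Balaban1983to89.Beta
open B4TorusKernel.MultiPeriod (translate)
open B6Lemma24Torus (pbox)
open AffineAveraging (Site)
open AveragingHessianKernels (Bond)
open AveragingContoursRooted (ctr)
open ExpKernelCalculus (MKer BiLoc)
open OneStepResolventKernel (Fib LocStencil)
open InterLevelTransport (SLam)
open Summit.QuantumFields.BalabanUV.Beta.SymAveragingHessianCounts (symLinKerAt)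
open Summit.QuantumFields.BalabanUV.Beta.BorderedHessian (stepScale)
open Summit.QuantumFields.BalabanUV.Beta.CompositeVertexKernelRec (compLinKer)
open Summit.QuantumFields.BalabanUV.Beta.FP.KernelPeriodisationFib (Idx perF)
open Summit.QuantumFields.BalabanUV.Beta.FP.KernelPeriodisationFibLoc (dper)
open Summit.QuantumFields.BalabanUV.Beta.FP.TorusCompositeObjects (towerTorus towerTorus_apply)
open Summit.QuantumFields.BalabanUV.Beta.FP.TorusCompositeObjectsG (compRowsSym)
open Summit.QuantumFields.BalabanUV.Beta.FP.TorusCompositeCompanionSumG (compSumSym)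
open Summit.QuantumFields.BalabanUV.Beta.FP.TorusCompositeCompanionFamilyG (onTowerFamily)
open Summit.QuantumFields.BalabanUV.Beta.FP.TorusCompositeRowsSymKernel (rowsLeg_translate exists_rowsLeg_window)
open Summit.QuantumFields.BalabanUV.Beta.FP.TorusCompositeRowsSymSandwich (compRowsSym_transpose_mul_perF_dper_mul)
open Summit.QuantumFields.BalabanUV.Beta.FP.TorusCompanionSumPeriodic (compSumSym_onTowerFamily_eq_perF_dper_sum)
open Summit.QuantumFields.BalabanUV.Beta.FP.TorusCompanionCorePeriodic (perF_dper_core_of_biLoc summable_core_diag summable_core_right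
  summable_ff_diag_of_biLoc summable_ff_right_of_biLoc)
open Summit.QuantumFields.BalabanUV.Beta.FP.TorusTwoScaleSandwichLetters (summable_sandwich_diag_of_tsum summable_dper_sandwich_right_of_tsum)

variable {d : ℕ} (Lc : ℕ) [NeZero Lc]

/-! ## §1 The storey tori of a sub-tower -/

omit [NeZero Lc] in
/-- [folklore] the finest torus of the `c`-storey tower over the storey torus `towerTorus Lc M j` is the storey torus `towerTorus Lc M (j + c)` (`towerTorus_apply`; `pow_add`). -/
theorem towerTorus_towerTorus (M : Fin (d + 1) → ℕ) (j c : ℕ) : towerTorus Lc (towerTorus Lc M j) c = towerTorus Lc M (j + c) := by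
  funext μ
  rw [towerTorus_apply, towerTorus_apply, towerTorus_apply, ← mul_assoc, ← pow_add, add_comm]

/-! ## §2 The Λ-companion sum, packed -/

/-- [folklore] **`compSumSym_lam_eq_perF_dper` — THE END WRAPPER's Λ-COMPANION SUM IS ONE PERIODISED LATTICE KERNEL ON THE FINEST TORUS.**  Data: `2 ≤ Lc`;
ONE brick list `ℓ` for the whole tower, displayed below the depth (`hℓ`); the Λ-brick family `𝒽` (the wrapper: `fun μ y => symHessFFAt ρ_c Lc μ y`), coefficients `cf k`,
weights `w k`, storey directions `hb k` (the wrapper's `hb n B k v`); the bricks `SLam N (cf j) 𝒽 κ u` bi-localised at their bond (`hLS`, an2's `LocStencil`); the storey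
kernels `𝒦 j` DISPLAYED window-free (`h𝒦`) as the sandwich of the core `w j · Σ_ā hb j ā · (SLam N (cf j) 𝒽 ā.2 ā.1)^{ff}` by an2's `compLinKer ℓ Lc (n − j)`.  Conclusion:
`compSumSym Lc (onTowerFamily Lc M (k ↦ w k • Σ_ā hb k ā • (perF (towerTorus Lc M k) (dper … (SLam N (cf k) 𝒽 ā.2 ā.1)))|ff)) M lev rs n = perF (towerTorus Lc M n) (dper … (Σ_{j<n} 𝒦 j))`. -/
theorem compSumSym_lam_eq_perF_dper (hLc : 2 ≤ Lc) (N n : ℕ) (M : Fin (d + 1) → ℕ) [∀ μ, NeZero (M μ)] (lev : ℕ → ℕ) (rs : ℕ → (Fin (d + 1) → ℕ))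
    (ℓ : ℕ → Fin (d + 1) → Site (d + 1) → Bond (d + 1) → ℝ)
    (hℓ : ∀ i < n, ∀ (μ : Fin (d + 1)) (y : Site (d + 1)) (g : Bond (d + 1)),
      ℓ i μ y g = stepScale d Lc (lev (n - i)) * ((Lc : ℝ) ^ (d + 1) * symLinKerAt (ctr (d + 1) Lc) Lc μ y g))
    (𝒽 : Fin (d + 1) → Site (d + 1) → MKer (d + 1) (Fib d))
    (cf : ℕ → Fin (d + 1) → Site (d + 1) → Fin (d + 1) → Site (d + 1) → ℝ) (w : ℕ → ℝ)
    (hb : (k : ℕ) → (↥(pbox (towerTorus Lc M k)) × Fin (d + 1) → ℝ))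
    {Cs : ℕ → ℝ} {δ : ℝ} (hLS : ∀ j, LocStencil (SLam N (cf j) 𝒽) (Cs j) δ) (hCs : ∀ j, 0 ≤ Cs j) (hδ : 0 < δ)
    {𝒦 : ℕ → MKer (d + 1) (Fin (d + 1))}
    (h𝒦 : ∀ j ≤ n, ∀ (β β' : Site (d + 1)) (b b' : Fin (d + 1)), 𝒦 j β β' b b'
      = ∑ a : Fin (d + 1), ∑ a' : Fin (d + 1), ∑' γ : Site (d + 1), ∑' γ' : Site (d + 1),
          compLinKer ℓ Lc (n - j) (b, β) (a, γ)
            * (w j * ∑ ā : ↥(pbox (towerTorus Lc M j)) × Fin (d + 1),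
                hb j ā * SLam N (cf j) 𝒽 ā.2 (ā.1 : Site (d + 1)) γ γ' (Sum.inl a) (Sum.inl a'))
            * compLinKer ℓ Lc (n - j) (b', β') (a', γ')) :
    compSumSym Lc (onTowerFamily Lc M (fun k => w k • ∑ ā : ↥(pbox (towerTorus Lc M k)) × Fin (d + 1), hb k ā •
        (perF (towerTorus Lc M k) (dper (towerTorus Lc M k) (SLam N (cf k) 𝒽 ā.2 (ā.1 : Site (d + 1))))).submatrix
          (fun p : ↥(pbox (towerTorus Lc M k)) × Fin (d + 1) => ((p.1, Sum.inl p.2) : Idx (towerTorus Lc M k) (Fib d)))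
          (fun p : ↥(pbox (towerTorus Lc M k)) × Fin (d + 1) => ((p.1, Sum.inl p.2) : Idx (towerTorus Lc M k) (Fib d))))) M lev rs n
      = perF (towerTorus Lc M n) (dper (towerTorus Lc M n) (∑ j ∈ Finset.range n, 𝒦 j)) := by
  -- per storey `j`: the bricks, their bi-localisation letters, the core's letters, the leg's letters at co-depth `c`
  have hV : ∀ (j : ℕ) (ā : ↥(pbox (towerTorus Lc M j)) × Fin (d + 1)),
      BiLoc (SLam N (cf j) 𝒽 ā.2 (ā.1 : Site (d + 1))) (ā.1 : Site (d + 1)) (ā.1 : Site (d + 1)) (Cs j) δ :=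
    fun j ā => hLS j ā.2 (ā.1 : Site (d + 1))
  have hSdV : ∀ (j : ℕ) (ā : ↥(pbox (towerTorus Lc M j)) × Fin (d + 1)) (x y : Site (d + 1)) (a b : Fin (d + 1)),
      Summable fun m₀ : Site (d + 1) => SLam N (cf j) 𝒽 ā.2 (ā.1 : Site (d + 1)) (translate (towerTorus Lc M j) x m₀) (translate (towerTorus Lc M j) y m₀)
        (Sum.inl a) (Sum.inl b) :=
    fun j => summable_ff_diag_of_biLoc (towerTorus Lc M j) (fun ā : ↥(pbox (towerTorus Lc M j)) × Fin (d + 1) => SLam N (cf j) 𝒽 ā.2 (ā.1 : Site (d + 1)))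
      (p := fun ā : ↥(pbox (towerTorus Lc M j)) × Fin (d + 1) => (ā.1 : Site (d + 1))) (q := fun ā : ↥(pbox (towerTorus Lc M j)) × Fin (d + 1) => (ā.1 : Site (d + 1))) (C := fun _ => Cs j) (δ := δ) (hV j) (fun _ => hCs j) hδ
  have hSpV : ∀ (j : ℕ) (ā : ↥(pbox (towerTorus Lc M j)) × Fin (d + 1)) (x y : Site (d + 1)) (a b : Fin (d + 1)),
      Summable fun m : Site (d + 1) => dper (towerTorus Lc M j) (SLam N (cf j) 𝒽 ā.2 (ā.1 : Site (d + 1))) x (translate (towerTorus Lc M j) y m)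
        (Sum.inl a) (Sum.inl b) :=
    fun j => summable_ff_right_of_biLoc (towerTorus Lc M j) (fun ā : ↥(pbox (towerTorus Lc M j)) × Fin (d + 1) => SLam N (cf j) 𝒽 ā.2 (ā.1 : Site (d + 1)))
      (p := fun ā : ↥(pbox (towerTorus Lc M j)) × Fin (d + 1) => (ā.1 : Site (d + 1))) (q := fun ā : ↥(pbox (towerTorus Lc M j)) × Fin (d + 1) => (ā.1 : Site (d + 1))) (C := fun _ => Cs j) (δ := δ) (hV j) (fun _ => hCs j) hδ
  have hGd : ∀ (j : ℕ) (x y : Site (d + 1)) (a b : Fin (d + 1)), Summable fun m₀ : Site (d + 1) =>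
      (fun x y (a b : Fin (d + 1)) => w j * ∑ ā : ↥(pbox (towerTorus Lc M j)) × Fin (d + 1),
          hb j ā * SLam N (cf j) 𝒽 ā.2 (ā.1 : Site (d + 1)) x y (Sum.inl a) (Sum.inl b))
        (translate (towerTorus Lc M j) x m₀) (translate (towerTorus Lc M j) y m₀) a b :=
    fun j => summable_core_diag (towerTorus Lc M j) (w j) (hb j) (fun ā : ↥(pbox (towerTorus Lc M j)) × Fin (d + 1) => SLam N (cf j) 𝒽 ā.2 (ā.1 : Site (d + 1))) (hSdV j)
  have hGp : ∀ (j : ℕ) (x y : Site (d + 1)) (a b : Fin (d + 1)), Summable fun m : Site (d + 1) =>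
      dper (towerTorus Lc M j) (fun x y (a b : Fin (d + 1)) => w j * ∑ ā : ↥(pbox (towerTorus Lc M j)) × Fin (d + 1),
          hb j ā * SLam N (cf j) 𝒽 ā.2 (ā.1 : Site (d + 1)) x y (Sum.inl a) (Sum.inl b)) x (translate (towerTorus Lc M j) y m) a b :=
    fun j => summable_core_right (towerTorus Lc M j) (w j) (hb j) (fun ā : ↥(pbox (towerTorus Lc M j)) × Fin (d + 1) => SLam N (cf j) 𝒽 ā.2 (ā.1 : Site (d + 1))) (hSdV j) (hSpV j)
  have hℓc : ∀ j c : ℕ, j + c = n → ∀ i < c, ∀ (μ : Fin (d + 1)) (y : Site (d + 1)) (g : Bond (d + 1)),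
      ℓ i μ y g = stepScale d Lc ((fun i => lev (i + j)) (c - i)) * ((Lc : ℝ) ^ (d + 1) * symLinKerAt (ctr (d + 1) Lc) Lc μ y g) :=
    fun j c hjc i hi μ y g => by rw [hℓ i (by omega), show n - i = c - i + j by omega]
  have h𝒦c : ∀ j c : ℕ, j + c = n → ∀ (β β' : Site (d + 1)) (b b' : Fin (d + 1)), 𝒦 j β β' b b'
      = ∑ a : Fin (d + 1), ∑ a' : Fin (d + 1), ∑' γ : Site (d + 1), ∑' γ' : Site (d + 1),
          compLinKer ℓ Lc c (b, β) (a, γ)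
            * (fun x y (a b : Fin (d + 1)) => w j * ∑ ā : ↥(pbox (towerTorus Lc M j)) × Fin (d + 1),
                hb j ā * SLam N (cf j) 𝒽 ā.2 (ā.1 : Site (d + 1)) x y (Sum.inl a) (Sum.inl b)) γ γ' a a'
            * compLinKer ℓ Lc c (b', β') (a', γ') :=
    fun j c hjc β β' b b' => by rw [h𝒦 j (by omega) β β' b b', show n - j = c by omega]
  refine compSumSym_onTowerFamily_eq_perF_dper_sum Lc hLc n M lev rs _ 𝒦 ?_ ?_ ?_
  · -- each storey packed at the named rows
    intro j c hjc
    exact (congrArg (fun X => (compRowsSym Lc (towerTorus Lc M j) (fun i => lev (i + j)) (fun i => rs (i + j)) c)ᵀ * X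
        * compRowsSym Lc (towerTorus Lc M j) (fun i => lev (i + j)) (fun i => rs (i + j)) c)
      (perF_dper_core_of_biLoc (towerTorus Lc M j) (fun ā : ↥(pbox (towerTorus Lc M j)) × Fin (d + 1) => SLam N (cf j) 𝒽 ā.2 (ā.1 : Site (d + 1)))
        (p := fun ā : ↥(pbox (towerTorus Lc M j)) × Fin (d + 1) => (ā.1 : Site (d + 1))) (q := fun ā : ↥(pbox (towerTorus Lc M j)) × Fin (d + 1) => (ā.1 : Site (d + 1))) (C := fun _ => Cs j) (δ := δ)
        (w j) (hb j) (hV j) (fun _ => hCs j) hδ).symm).trans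
      (compRowsSym_transpose_mul_perF_dper_mul Lc (towerTorus Lc M j) (fun i => lev (i + j)) (fun i => rs (i + j)) c ℓ (hℓc j c hjc)
        (fun x y (a b : Fin (d + 1)) => w j * ∑ ā : ↥(pbox (towerTorus Lc M j)) × Fin (d + 1),
          hb j ā * SLam N (cf j) 𝒽 ā.2 (ā.1 : Site (d + 1)) x y (Sum.inl a) (Sum.inl b))
        (hGd j) (hGp j) (h𝒦c j c hjc))
  · -- the sandwich's diagonal letter on the finest torus
    intro j hj x y a b
    obtain ⟨S, hS⟩ := exists_rowsLeg_window Lc (n - j) ℓ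
    have h := summable_sandwich_diag_of_tsum (towerTorus Lc M j) (towerTorus Lc (towerTorus Lc M j) (n - j))
      (fun γ a β b => compLinKer ℓ Lc (n - j) (b, β) (a, γ))
      (fun m γ a β b => rowsLeg_translate Lc (towerTorus Lc M j) (fun i => lev (i + j)) (n - j) ℓ (hℓc j (n - j) (by omega)) m γ a β b)
      S (fun γ a β b h => hS γ a β b h)
      (fun x y (a b : Fin (d + 1)) => w j * ∑ ā : ↥(pbox (towerTorus Lc M j)) × Fin (d + 1),
          hb j ā * SLam N (cf j) 𝒽 ā.2 (ā.1 : Site (d + 1)) x y (Sum.inl a) (Sum.inl b))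
      (h𝒦c j (n - j) (by omega)) (hGd j) x y a b
    rwa [towerTorus_towerTorus, show j + (n - j) = n by omega] at h
  · -- the sandwich's second-argument letter on the finest torus
    intro j hj x y a b
    obtain ⟨S, hS⟩ := exists_rowsLeg_window Lc (n - j) ℓ
    have h := summable_dper_sandwich_right_of_tsum (towerTorus Lc M j) (towerTorus Lc (towerTorus Lc M j) (n - j))
      (fun γ a β b => compLinKer ℓ Lc (n - j) (b, β) (a, γ))
      (fun m γ a β b => rowsLeg_translate Lc (towerTorus Lc M j) (fun i => lev (i + j)) (n - j) ℓ (hℓc j (n - j) (by omega)) m γ a β b)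
      S (fun γ a β b h => hS γ a β b h)
      (fun x y (a b : Fin (d + 1)) => w j * ∑ ā : ↥(pbox (towerTorus Lc M j)) × Fin (d + 1),
          hb j ā * SLam N (cf j) 𝒽 ā.2 (ā.1 : Site (d + 1)) x y (Sum.inl a) (Sum.inl b))
      (h𝒦c j (n - j) (by omega)) (hGd j) (hGp j) x y a b
    rwa [towerTorus_towerTorus, show j + (n - j) = n by omega] at h

end Summit.QuantumFields.BalabanUV.Beta.FP.TorusCompanionLamPacked

end
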